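import Summits.CriticalPhenomena.SAWScalingLimit.Theorems.SAWDefectDecoherenceBoundaryClosureRDevelopingMapByParts
import HarnessLib

/-!
# The developing map against test functions: the estimate at one scale
(crux `BoundaryClosureR`, stmt-CriticalPhenomena-14004, line `pick-half-plane`,
stub `stub_developingMapLimitHolomorphic`)

Deterministic bookkeeping at ONE mesh `δ ≤ ε₀` for a test function `φ` supported in `K` with
`cthickening (3ε₀) K` exhausted by the faces of `S`: the set of sites
`T = {s lattice site of S | δ s ∈ cthickening (2ε₀) K}` is interior and closed under the spokes of
the sites near `K` (`sites_setup`), the cover bound for the first by-parts error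
(`cover_indicator_norm_le`), and the ONE-SCALE ESTIMATE `one_scale` (registered helper
`developingMapLimitHolomorphic_oneScale`):

  `‖δ² Σ_T Σ_k φ(δ·mid(edge s k)) w_k F(edge s k)/F_b + δ² Σ_T h(δ s) Ψ(δ s)‖`
     `≤ δ·(L C₁ + 24 M (B_h + 1) N₁) + η C_Ψ N₁`,            `Ψ = A ∂φ + B ∂̄φ`,

given the by-parts increments of `hh` (the normalised developing map), the local `L¹` bound
`C₁`, the lattice-point count `N₁`, the sup `B_h` of the limit `h` near `K`, the uniform distance
`η` between `hh` and `h(δ·)` on the sites near `K`, and `‖Ψ‖ ≤ C_Ψ`.  No limit is taken here.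
References: Duminil-Copin–Smirnov (2012) §3; folklore.
-/

noncomputable section

open scoped BigOperators ComplexConjugate Topology NNReal Classical
open Finset Set Metric Complex
open Literature.Probability.LatticeModels Literature.Probability.RandomPlanarGeometry
open Literature.Probability.RandomPlanarGeometry.SAW
open Literature.Barriers.CriticalPhenomena Literature.Barriers.CriticalPhenomena.HexKernel
open Literature.Analysis.Complex (dbarAlong dbarAlong_one)
open Summit.CriticalPhenomena.SAWScalingLimit.Theorems.PickHalfPlane
open Summit.CriticalPhenomena.SAWScalingLimit.Theorems.PickHalfPlane.Hexagon
open Summit.CriticalPhenomena.SAWScalingLimit.Theorems.PickHalfPlane.Engine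
open Summit.CriticalPhenomena.SAWScalingLimit.Theorems.MassRatio.Negative (hexDomainMidEdges_finite)

namespace Summit.CriticalPhenomena.SAWScalingLimit.Theorems.PickHalfPlane.DevelopingMap

/-! ### Closed thickenings -/

/-- Thickening arithmetic: a point within `d` of a point of `cthickening r K` lies in
`cthickening (d + r) K`. [folklore] -/
theorem mem_cthickening_add {K : Set ℂ} {x y : ℂ} {r d : ℝ} (hr : 0 ≤ r) (hd : 0 ≤ d)
    (hy : y ∈ cthickening r K) (hxy : dist x y ≤ d) : x ∈ cthickening (d + r) K :=
  cthickening_cthickening_subset hd hr K (mem_cthickening_of_dist_le x y d _ hy hxy)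

/-- The scaled spoke endpoint is at distance `δ` from the scaled site. [folklore] -/
theorem norm_scaled_spoke_sub (s : Site 2) (k : Fin 6) (δ : ℝ) :
    ‖(δ : ℂ) * triEmbed (spoke s k) - (δ : ℂ) * triEmbed s‖ = |δ| := by
  rw [triEmbed_spoke, ← mul_sub, add_sub_cancel_left, norm_mul, Complex.norm_real,
    Real.norm_eq_abs, norm_triEmbed_spoke_zero, mul_one]

/-! ### The sites near the support -/

/-- **The sites near the support of the test function.**  Let `0 < δ ≤ ε₀`, let every face with
scaled centre in `cthickening (3ε₀) K` belong to `S`, and let `T` be the set of lattice sites of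
`S` with scaled position in `cthickening (2ε₀) K`.  Then (a) every site with scaled position in
`cthickening (2ε₀) K` is interior and in `T`; (b) the spokes of a site with scaled position in
`cthickening ε₀ K` are in `T`; (c) a hexagon edge with scaled midpoint in `cthickening ε₀ K`
has its site in `T` and both faces in `S`. [folklore] -/
theorem sites_setup (S : Finset HexVertex) (K : Set ℂ) {ε₀ δ : ℝ} (hε₀ : 0 < ε₀) (hδ : 0 < δ)
    (hδε : δ ≤ ε₀)
    (hexh : ∀ v : HexVertex, (δ : ℂ) * hexCenter v ∈ cthickening (3 * ε₀) K → v ∈ S)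
    (T : Finset (Site 2))
    (hT : ∀ s : Site 2, s ∈ T ↔ IsLatticeSite S s ∧ (δ : ℂ) * triEmbed s ∈ cthickening (2 * ε₀) K) :
    (∀ s : Site 2, (δ : ℂ) * triEmbed s ∈ cthickening (2 * ε₀) K → IsInteriorSite S s ∧ s ∈ T) ∧
    (∀ s : Site 2, (δ : ℂ) * triEmbed s ∈ cthickening ε₀ K → ∀ k : Fin 6, spoke s k ∈ T) ∧
    (∀ (s : Site 2) (k : Fin 6), (δ : ℂ) * hexMidpoint (edge s k) ∈ cthickening ε₀ K →
      s ∈ T ∧ face s k ∈ S ∧ face s (k + 1) ∈ S) := by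
  have ha : ∀ s : Site 2, (δ : ℂ) * triEmbed s ∈ cthickening (2 * ε₀) K →
      IsInteriorSite S s ∧ s ∈ T := by
    intro s hs
    have hint : IsInteriorSite S s := by
      refine isInteriorSite_of_scaled hδ fun f hf => hexh f ?_
      have h := mem_cthickening_add (by positivity) hδ.le hs (by rw [dist_eq_norm]; exact hf)
      exact cthickening_mono (by linarith) K h
    exact ⟨hint, (hT s).2 ⟨hint.isLatticeSite, hs⟩⟩
  refine ⟨ha, fun s hs k => ?_, fun s k hs => ?_⟩
  · refine (ha (spoke s k) ?_).2
    have h := mem_cthickening_add hε₀.le hδ.le hs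
      (show dist ((δ : ℂ) * triEmbed (spoke s k)) ((δ : ℂ) * triEmbed s) ≤ δ by
        rw [dist_eq_norm, norm_scaled_spoke_sub, abs_of_pos hδ])
    exact cthickening_mono (by linarith) K h
  · have hs' : (δ : ℂ) * triEmbed s ∈ cthickening (2 * ε₀) K := by
      have h := mem_cthickening_add hε₀.le (by positivity : (0 : ℝ) ≤ δ / 2) hs
        (show dist ((δ : ℂ) * triEmbed s) ((δ : ℂ) * hexMidpoint (edge s k)) ≤ δ / 2 by
          rw [dist_comm, dist_eq_norm, norm_scaled_hexMidpoint_edge_sub, abs_of_pos hδ])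
      exact cthickening_mono (by linarith) K h
    obtain ⟨hint, hsT⟩ := ha s hs'
    exact ⟨hsT, hint _ (mem_hexFaceVertices_face s k), hint _ (mem_hexFaceVertices_face s (k + 1))⟩
/-! ### The cover bound for the first error term -/

/-- **Cover bound.** If every hexagon edge `edge s k` whose scaled midpoint lies in `K₁` has
`s ∈ T` and both faces in `S`, then
`Σ_{s∈T}Σ_k 1[δ·mid(edge s k) ∈ K₁] ‖G(edge s k)‖ ≤ 2 Σᶠ_{z ∈ Ω_S, δ·mid z ∈ K₁} ‖G z‖`
(each mid-edge is covered twice, `pickEngine_midEdgeCover`). [folklore] -/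
theorem cover_indicator_norm_le (S : Finset HexVertex) (T : Finset (Site 2))
    (G : Sym2 HexVertex → ℂ) (δ : ℝ) (K₁ : Set ℂ) [DecidablePred (· ∈ K₁)]
    (hT : ∀ (s : Site 2) (k : Fin 6), (δ : ℂ) * hexMidpoint (edge s k) ∈ K₁ →
      s ∈ T ∧ face s k ∈ S ∧ face s (k + 1) ∈ S) :
    ∑ s ∈ T, ∑ k : Fin 6, (if (δ : ℂ) * hexMidpoint (edge s k) ∈ K₁ then ‖G (edge s k)‖ else 0) ≤
      2 * ∑ᶠ z ∈ {z : Sym2 HexVertex | z ∈ hexDomainMidEdges S ∧ (δ : ℂ) * hexMidpoint z ∈ K₁},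
        ‖G z‖ := by
  classical
  set g : Sym2 HexVertex → ℝ := fun z => if (δ : ℂ) * hexMidpoint z ∈ K₁ then ‖G z‖ else 0 with hg
  have hcover := pickEngine_midEdgeCover S T (fun z => ((g z : ℝ) : ℂ)) (fun s k hne => by
    have : (δ : ℂ) * hexMidpoint (edge s k) ∈ K₁ := by
      by_contra h; exact hne (by simp [hg, h])
    exact hT s k this)
  have hE := hexDomainMidEdges_finite S
  set E : Set (Sym2 HexVertex) := {z | z ∈ hexDomainMidEdges S ∧ (δ : ℂ) * hexMidpoint z ∈ K₁} with hEdef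
  have hEfin : E.Finite := hE.subset fun z hz => hz.1
  -- real form of the cover identity
  have hreal : ∑ s ∈ T, ∑ k : Fin 6, g (edge s k) = 2 * ∑ᶠ z ∈ hexDomainMidEdges S, g z := by
    have h2 : (∑ᶠ z ∈ hexDomainMidEdges S, ((g z : ℝ) : ℂ)) =
        ((∑ᶠ z ∈ hexDomainMidEdges S, g z : ℝ) : ℂ) := by
      rw [finsum_mem_eq_finite_toFinset_sum _ hE, finsum_mem_eq_finite_toFinset_sum _ hE]
      push_cast; rfl
    rw [h2] at hcover
    exact_mod_cast hcover
  have hsplit : ∑ᶠ z ∈ hexDomainMidEdges S, g z = ∑ᶠ z ∈ E, ‖G z‖ := by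
    rw [finsum_mem_eq_finite_toFinset_sum _ hE, finsum_mem_eq_finite_toFinset_sum _ hEfin]
    rw [← Finset.sum_filter_add_sum_filter_not hE.toFinset (fun z => (δ : ℂ) * hexMidpoint z ∈ K₁)]
    have h0 : ∑ z ∈ hE.toFinset.filter (fun z => ¬ (δ : ℂ) * hexMidpoint z ∈ K₁), g z = 0 :=
      Finset.sum_eq_zero fun z hz => by simp only [hg, if_neg (Finset.mem_filter.1 hz).2]
    rw [h0, add_zero]
    have hset : hE.toFinset.filter (fun z => (δ : ℂ) * hexMidpoint z ∈ K₁) = hEfin.toFinset := by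
      ext z
      simp only [Finset.mem_filter, Set.Finite.mem_toFinset, hEdef, Set.mem_setOf_eq]
    rw [hset]
    exact Finset.sum_congr rfl fun z hz => by
      simp only [hg, if_pos (hEfin.mem_toFinset.1 hz).2]
  rw [← hsplit, ← hreal]

/-! ### The estimate at one scale -/

/-- The Wirtinger combination `Ψ = A ∂φ + B ∂̄φ` vanishes off the support of `φ`. [folklore] -/
theorem wirtinger_eq_zero_of_notMem {φ : ℂ → ℂ} {z : ℂ} (hz : z ∉ tsupport φ) (A B : ℂ) :
    A * ((2 : ℂ)⁻¹ * (fderiv ℝ φ z 1 - I * fderiv ℝ φ z I)) + B * dbarAlong 1 φ z = 0 := by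
  have hD : fderiv ℝ φ z = 0 := by
    by_contra hne
    exact hz (support_fderiv_subset ℝ (Function.mem_support.2 hne))
  simp [dbarAlong_one, hD]

/-- **The one-scale estimate (registered helper `developingMapLimitHolomorphic_oneScale`).**
See the module docstring.  Hypotheses: the by-parts increments of `hh` against `G = F/F_b`;
Lipschitz/Taylor data of `φ`; weights with frame constants; the scale `0 < δ ≤ ε₀`; exhaustion
of `cthickening (3ε₀) K` by `S` (`K = tsupport φ`); the local `L¹` bound on `cthickening ε₀ K`;
the lattice-point count there; the sup of `h` on `cthickening (2ε₀) K`; the uniform closeness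
`‖hh s − h(δ s)‖ < η ≤ 1` at the lattice sites there; `‖Ψ‖ ≤ C_Ψ`.  Conclusion:
`‖δ² Σ_T Σ_k φ(δ·mid) w_k G + δ² Σ_T h(δ s)Ψ(δ s)‖ ≤ δ(L C₁ + 24M(B_h+1)N₁) + η C_Ψ N₁`.
[folklore] -/
theorem one_scale (S : Finset HexVertex) (F : Sym2 HexVertex → ℂ) (Fb : ℂ) (hh : Site 2 → ℂ)
    (h φ : ℂ → ℂ) {L : ℝ≥0} {M δ ε₀ C₁ N₁ Bh η CΨ : ℝ} (w : Fin 6 → ℂ) (A B : ℂ)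
    (hHF : ∀ (s : Site 2) (k : Fin 6), IsInteriorSite S s →
      hh (spoke s k) - hh s = mvec k * ((δ : ℂ) * (F (edge s k) / Fb)))
    (hL : LipschitzWith L φ)
    (hM : ∀ z y : ℂ, ‖φ (z + y) - φ z - fderiv ℝ φ z y‖ ≤ M * ‖y‖ ^ 2) (hM0 : 0 ≤ M)
    (hw : ∀ k, ‖w k‖ ≤ 1)
    (hframe : ∀ P Q : ℂ, ∑ k : Fin 6, w k * (12 * conj (mvec k)) *
      (P * triEmbed (spoke 0 k) + Q * conj (triEmbed (spoke 0 k))) = A * P + B * Q)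
    (hε₀ : 0 < ε₀) (hδ : 0 < δ) (hδε : δ ≤ ε₀)
    (hexh : ∀ v : HexVertex, (δ : ℂ) * hexCenter v ∈ cthickening (3 * ε₀) (tsupport φ) → v ∈ S)
    (hC₁ : 0 ≤ C₁)
    (hL1 : δ ^ 2 * (∑ᶠ z ∈ {z : Sym2 HexVertex | z ∈ hexDomainMidEdges S ∧
        (δ : ℂ) * hexMidpoint z ∈ cthickening ε₀ (tsupport φ)}, ‖F z‖) ≤ C₁ * ‖Fb‖)
    (hN₁ : ∀ T' : Finset (Site 2), (∀ s ∈ T', (δ : ℂ) * triEmbed s ∈ cthickening ε₀ (tsupport φ)) →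
      δ ^ 2 * (T'.card : ℝ) ≤ N₁)
    (hBh0 : 0 ≤ Bh) (hBh : ∀ z ∈ cthickening (2 * ε₀) (tsupport φ), ‖h z‖ ≤ Bh)
    (hη : 0 < η) (hη1 : η ≤ 1)
    (hconv : ∀ s : Site 2, IsLatticeSite S s →
      (δ : ℂ) * triEmbed s ∈ cthickening (2 * ε₀) (tsupport φ) → ‖hh s - h ((δ : ℂ) * triEmbed s)‖ < η)
    (hΨ : ∀ z, ‖A * ((2 : ℂ)⁻¹ * (fderiv ℝ φ z 1 - I * fderiv ℝ φ z I)) + B * dbarAlong 1 φ z‖ ≤ CΨ) :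
    ‖(δ : ℂ) ^ 2 * ∑ s ∈ (S.biUnion hexFaceVertices).filter
          (fun s => (δ : ℂ) * triEmbed s ∈ cthickening (2 * ε₀) (tsupport φ)),
        ∑ k : Fin 6, φ ((δ : ℂ) * hexMidpoint (edge s k)) * w k * (F (edge s k) / Fb) +
      (δ : ℂ) ^ 2 * ∑ s ∈ (S.biUnion hexFaceVertices).filter
          (fun s => (δ : ℂ) * triEmbed s ∈ cthickening (2 * ε₀) (tsupport φ)),
        h ((δ : ℂ) * triEmbed s) * (A * ((2 : ℂ)⁻¹ * (fderiv ℝ φ ((δ : ℂ) * triEmbed s) 1 -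
          I * fderiv ℝ φ ((δ : ℂ) * triEmbed s) I)) + B * dbarAlong 1 φ ((δ : ℂ) * triEmbed s))‖ ≤
      δ * (L * C₁ + 24 * M * (Bh + 1) * N₁) + η * CΨ * N₁ := by
  ---------------------------------------------------------------- notation
  set K : Set ℂ := tsupport φ with hKdef
  set K₁ : Set ℂ := cthickening ε₀ K with hK₁
  set K₂ : Set ℂ := cthickening (2 * ε₀) K with hK₂
  set T : Finset (Site 2) := (S.biUnion hexFaceVertices).filter
    (fun s => (δ : ℂ) * triEmbed s ∈ K₂) with hTdef
  set G : Sym2 HexVertex → ℂ := fun z => F z / Fb with hG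
  set Ψ : ℂ → ℂ := fun z => A * ((2 : ℂ)⁻¹ * (fderiv ℝ φ z 1 - I * fderiv ℝ φ z I)) +
    B * dbarAlong 1 φ z with hΨdef
  have hTmem : ∀ s : Site 2, s ∈ T ↔ IsLatticeSite S s ∧ (δ : ℂ) * triEmbed s ∈ K₂ := by
    intro s
    simp only [hTdef, Finset.mem_filter, Finset.mem_biUnion, IsLatticeSite]
  obtain ⟨hTa, hTb, hTc⟩ := sites_setup S K hε₀ hδ hδε hexh T hTmem
  have hKδ1 : cthickening δ K ⊆ K₁ := cthickening_mono hδε K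
  have hK12 : K₁ ⊆ K₂ := cthickening_mono (by linarith) K
  have hKK1 : K ⊆ K₁ := self_subset_cthickening K
  have hCΨ : 0 ≤ CΨ := (norm_nonneg _).trans (hΨ 0)
  ---------------------------------------------------------------- the by-parts estimate
  have hTbp : ∀ s : Site 2, (δ : ℂ) * triEmbed s ∈ cthickening δ (tsupport φ) →
      IsInteriorSite S s ∧ s ∈ T ∧ ∀ k, spoke s k ∈ T := fun s hs =>
    ⟨(hTa s (hK12 (hKδ1 hs))).1, (hTa s (hK12 (hKδ1 hs))).2, hTb s (hKδ1 hs)⟩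
  have hest := byParts_estimate S T G hh φ w A B hHF hL hM hw hframe hδ hTbp
  ---------------------------------------------------------------- (P1) the first error term
  have hP1 : δ ^ 2 * ∑ s ∈ T, ∑ k : Fin 6,
      (if (δ : ℂ) * hexMidpoint (edge s k) ∈ cthickening δ (tsupport φ) then ‖G (edge s k)‖ else 0) ≤
      2 * C₁ := by
    have h1 : ∑ s ∈ T, ∑ k : Fin 6,
        (if (δ : ℂ) * hexMidpoint (edge s k) ∈ cthickening δ (tsupport φ) then ‖G (edge s k)‖ else 0) ≤
        ∑ s ∈ T, ∑ k : Fin 6,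
          (if (δ : ℂ) * hexMidpoint (edge s k) ∈ K₁ then ‖G (edge s k)‖ else 0) := by
      refine Finset.sum_le_sum fun s _ => Finset.sum_le_sum fun k _ => ?_
      split_ifs with ha hb
      · exact le_rfl
      · exact absurd (hKδ1 ha) hb
      · exact norm_nonneg _
      · exact le_rfl
    have h2 := cover_indicator_norm_le S T G δ K₁ hTc
    have h3 : (∑ᶠ z ∈ {z : Sym2 HexVertex | z ∈ hexDomainMidEdges S ∧ (δ : ℂ) * hexMidpoint z ∈ K₁},
        ‖G z‖) = (∑ᶠ z ∈ {z : Sym2 HexVertex | z ∈ hexDomainMidEdges S ∧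
          (δ : ℂ) * hexMidpoint z ∈ K₁}, ‖F z‖) * ‖Fb‖⁻¹ := by
      rw [finsum_mem_mul]
      exact finsum_mem_congr rfl fun z _ => by rw [hG]; simp [div_eq_mul_inv]
    have h4 : δ ^ 2 * ((∑ᶠ z ∈ {z : Sym2 HexVertex | z ∈ hexDomainMidEdges S ∧
        (δ : ℂ) * hexMidpoint z ∈ K₁}, ‖F z‖) * ‖Fb‖⁻¹) ≤ C₁ := by
      by_cases hFb : ‖Fb‖ = 0
      · rw [hFb, inv_zero, mul_zero, mul_zero]; exact hC₁
      · have hFb' : 0 < ‖Fb‖ := lt_of_le_of_ne (norm_nonneg _) (Ne.symm hFb)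
        rw [← mul_assoc, ← div_eq_mul_inv, div_le_iff₀ hFb']
        exact hL1
    calc δ ^ 2 * ∑ s ∈ T, ∑ k : Fin 6,
          (if (δ : ℂ) * hexMidpoint (edge s k) ∈ cthickening δ (tsupport φ) then ‖G (edge s k)‖ else 0)
        ≤ δ ^ 2 * (2 * ((∑ᶠ z ∈ {z : Sym2 HexVertex | z ∈ hexDomainMidEdges S ∧
            (δ : ℂ) * hexMidpoint z ∈ K₁}, ‖F z‖) * ‖Fb‖⁻¹)) := by
          rw [← h3]; exact mul_le_mul_of_nonneg_left (h1.trans h2) (sq_nonneg δ)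
      _ = 2 * (δ ^ 2 * ((∑ᶠ z ∈ {z : Sym2 HexVertex | z ∈ hexDomainMidEdges S ∧
            (δ : ℂ) * hexMidpoint z ∈ K₁}, ‖F z‖) * ‖Fb‖⁻¹)) := by ring
      _ ≤ 2 * C₁ := by linarith
  ---------------------------------------------------------------- (P2) the second error term
  have hcard : δ ^ 2 * ((T.filter fun s => (δ : ℂ) * triEmbed s ∈ K₁).card : ℝ) ≤ N₁ :=
    hN₁ _ fun s hs => (Finset.mem_filter.1 hs).2
  have hP2 : δ ^ 2 * ∑ s ∈ T,
      (if (δ : ℂ) * triEmbed s ∈ cthickening δ (tsupport φ) then ‖hh s‖ else 0) ≤ (Bh + 1) * N₁ := by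
    have h1 : ∑ s ∈ T, (if (δ : ℂ) * triEmbed s ∈ cthickening δ (tsupport φ) then ‖hh s‖ else 0) ≤
        ∑ s ∈ T, (if (δ : ℂ) * triEmbed s ∈ K₁ then (Bh + 1) else 0) := by
      refine Finset.sum_le_sum fun s hs => ?_
      split_ifs with ha hb
      · have hs2 : (δ : ℂ) * triEmbed s ∈ K₂ := hK12 hb
        have hc := hconv s ((hTmem s).1 hs).1 hs2
        have hb' := hBh _ hs2
        calc ‖hh s‖ = ‖h ((δ : ℂ) * triEmbed s) + (hh s - h ((δ : ℂ) * triEmbed s))‖ := by ring_nf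
          _ ≤ ‖h ((δ : ℂ) * triEmbed s)‖ + ‖hh s - h ((δ : ℂ) * triEmbed s)‖ := norm_add_le _ _
          _ ≤ Bh + 1 := by linarith
      · exact absurd (hKδ1 ha) hb
      · positivity
      · exact le_rfl
    have h2 : ∑ s ∈ T, (if (δ : ℂ) * triEmbed s ∈ K₁ then (Bh + 1) else 0) =
        (Bh + 1) * ((T.filter fun s => (δ : ℂ) * triEmbed s ∈ K₁).card : ℝ) := by
      rw [← Finset.sum_filter, Finset.sum_const, nsmul_eq_mul, mul_comm]
    calc δ ^ 2 * ∑ s ∈ T, (if (δ : ℂ) * triEmbed s ∈ cthickening δ (tsupport φ) then ‖hh s‖ else 0)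
        ≤ δ ^ 2 * ((Bh + 1) * ((T.filter fun s => (δ : ℂ) * triEmbed s ∈ K₁).card : ℝ)) := by
          rw [← h2]; exact mul_le_mul_of_nonneg_left h1 (sq_nonneg δ)
      _ = (Bh + 1) * (δ ^ 2 * ((T.filter fun s => (δ : ℂ) * triEmbed s ∈ K₁).card : ℝ)) := by ring
      _ ≤ (Bh + 1) * N₁ := mul_le_mul_of_nonneg_left hcard (by positivity)
  ---------------------------------------------------------------- (P3) `hh` versus `h`
  have hP3 : ‖(δ : ℂ) ^ 2 * ∑ s ∈ T, hh s * Ψ ((δ : ℂ) * triEmbed s) -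
      (δ : ℂ) ^ 2 * ∑ s ∈ T, h ((δ : ℂ) * triEmbed s) * Ψ ((δ : ℂ) * triEmbed s)‖ ≤ η * CΨ * N₁ := by
    rw [← mul_sub, ← Finset.sum_sub_distrib, norm_mul, norm_pow, Complex.norm_real,
      Real.norm_eq_abs, abs_of_pos hδ]
    have h1 : ‖∑ s ∈ T, (hh s * Ψ ((δ : ℂ) * triEmbed s) - h ((δ : ℂ) * triEmbed s) *
        Ψ ((δ : ℂ) * triEmbed s))‖ ≤ ∑ s ∈ T, (if (δ : ℂ) * triEmbed s ∈ K₁ then η * CΨ else 0) := by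
      refine (norm_sum_le _ _).trans (Finset.sum_le_sum fun s hs => ?_)
      rw [← sub_mul, norm_mul]
      split_ifs with ha
      · have hc := hconv s ((hTmem s).1 hs).1 (hK12 ha)
        exact mul_le_mul hc.le (hΨ _) (norm_nonneg _) hη.le
      · have hK' : (δ : ℂ) * triEmbed s ∉ tsupport φ := fun h' => ha (hKK1 h')
        rw [show Ψ ((δ : ℂ) * triEmbed s) = 0 from wirtinger_eq_zero_of_notMem hK' A B]
        simp
    have h2 : ∑ s ∈ T, (if (δ : ℂ) * triEmbed s ∈ K₁ then η * CΨ else 0) =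
        η * CΨ * ((T.filter fun s => (δ : ℂ) * triEmbed s ∈ K₁).card : ℝ) := by
      rw [← Finset.sum_filter, Finset.sum_const, nsmul_eq_mul, mul_comm]
    calc δ ^ 2 * ‖∑ s ∈ T, (hh s * Ψ ((δ : ℂ) * triEmbed s) -
          h ((δ : ℂ) * triEmbed s) * Ψ ((δ : ℂ) * triEmbed s))‖
        ≤ δ ^ 2 * (η * CΨ * ((T.filter fun s => (δ : ℂ) * triEmbed s ∈ K₁).card : ℝ)) := by
          rw [← h2]; exact mul_le_mul_of_nonneg_left h1 (sq_nonneg δ)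
      _ = η * CΨ * (δ ^ 2 * ((T.filter fun s => (δ : ℂ) * triEmbed s ∈ K₁).card : ℝ)) := by ring
      _ ≤ η * CΨ * N₁ := mul_le_mul_of_nonneg_left hcard (by positivity)
  ---------------------------------------------------------------- combination
  set X' : ℂ := ∑ s ∈ T, ∑ k : Fin 6, φ ((δ : ℂ) * hexMidpoint (edge s k)) * w k * G (edge s k)
    with hX'
  set Main : ℂ := ∑ s ∈ T, hh s * Ψ ((δ : ℂ) * triEmbed s) with hMain
  set R' : ℂ := ∑ s ∈ T, h ((δ : ℂ) * triEmbed s) * Ψ ((δ : ℂ) * triEmbed s) with hR'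
  have hsplit : (δ : ℂ) ^ 2 * X' + (δ : ℂ) ^ 2 * R' =
      (δ : ℂ) ^ 2 * (X' + Main) - ((δ : ℂ) ^ 2 * Main - (δ : ℂ) ^ 2 * R') := by ring
  have hL0 : (0 : ℝ) ≤ L := L.2
  calc ‖(δ : ℂ) ^ 2 * X' + (δ : ℂ) ^ 2 * R'‖
      = ‖(δ : ℂ) ^ 2 * (X' + Main) - ((δ : ℂ) ^ 2 * Main - (δ : ℂ) ^ 2 * R')‖ := by rw [hsplit]
    _ ≤ ‖(δ : ℂ) ^ 2 * (X' + Main)‖ + ‖(δ : ℂ) ^ 2 * Main - (δ : ℂ) ^ 2 * R'‖ := norm_sub_le _ _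
    _ ≤ δ ^ 2 * ((L : ℝ) * δ / 2 * ∑ s ∈ T, ∑ k : Fin 6,
          (if (δ : ℂ) * hexMidpoint (edge s k) ∈ cthickening δ (tsupport φ) then ‖G (edge s k)‖ else 0) +
          24 * M * δ * ∑ s ∈ T,
            (if (δ : ℂ) * triEmbed s ∈ cthickening δ (tsupport φ) then ‖hh s‖ else 0)) +
        η * CΨ * N₁ := by
        refine add_le_add ?_ hP3
        rw [norm_mul, norm_pow, Complex.norm_real, Real.norm_eq_abs, abs_of_pos hδ]
        exact mul_le_mul_of_nonneg_left hest (sq_nonneg δ)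
    _ = (L : ℝ) * δ / 2 * (δ ^ 2 * ∑ s ∈ T, ∑ k : Fin 6,
          (if (δ : ℂ) * hexMidpoint (edge s k) ∈ cthickening δ (tsupport φ) then ‖G (edge s k)‖ else 0)) +
          24 * M * δ * (δ ^ 2 * ∑ s ∈ T,
            (if (δ : ℂ) * triEmbed s ∈ cthickening δ (tsupport φ) then ‖hh s‖ else 0)) +
        η * CΨ * N₁ := by ring
    _ ≤ (L : ℝ) * δ / 2 * (2 * C₁) + 24 * M * δ * ((Bh + 1) * N₁) + η * CΨ * N₁ := by
        gcongr
    _ = δ * (L * C₁ + 24 * M * (Bh + 1) * N₁) + η * CΨ * N₁ := by ring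


/-- **Registered helper `developingMapLimitHolomorphic_oneScale`** (crux stmt-CriticalPhenomena-14004, line
`pick-half-plane`, stub `stub_developingMapLimitHolomorphic`): registry form (one `∀`-term) of `one_scale`.
[folklore] -/
theorem developingMapLimitHolomorphic_oneScale : ∀ (S : Finset HexVertex) (F : Sym2 HexVertex → ℂ) (Fb : ℂ) (hh : Site 2 → ℂ) (h φ : ℂ → ℂ) {L : ℝ≥0} {M δ ε₀ C₁ N₁ Bh η CΨ : ℝ} (w : Fin 6 → ℂ) (A B : ℂ) (hHF : ∀ (s : Site 2) (k : Fin 6), IsInteriorSite S s → hh (spoke s k) - hh s = mvec k * ((δ : ℂ) * (F (edge s k) / Fb))) (hL : LipschitzWith L φ) (hM : ∀ z y : ℂ, ‖φ (z + y) - φ z - fderiv ℝ φ z y‖ ≤ M * ‖y‖ ^ 2) (hM0 : 0 ≤ M) (hw : ∀ k, ‖w k‖ ≤ 1) (hframe : ∀ P Q : ℂ, ∑ k : Fin 6, w k * (12 * conj (mvec k)) * (P * triEmbed (spoke 0 k) + Q * conj (triEmbed (spoke 0 k))) = A * P + B * Q) (hε₀ : 0 < ε₀) (hδ : 0 < δ)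 (hδε : δ ≤ ε₀) (hexh : ∀ v : HexVertex, (δ : ℂ) * hexCenter v ∈ cthickening (3 * ε₀) (tsupport φ) → v ∈ S) (hC₁ : 0 ≤ C₁) (hL1 : δ ^ 2 * (∑ᶠ z ∈ {z : Sym2 HexVertex | z ∈ hexDomainMidEdges S ∧ (δ : ℂ) * hexMidpoint z ∈ cthickening ε₀ (tsupport φ)}, ‖F z‖) ≤ C₁ * ‖Fb‖) (hN₁ : ∀ T' : Finset (Site 2), (∀ s ∈ T', (δ : ℂ) * triEmbed s ∈ cthickening ε₀ (tsupport φ)) → δ ^ 2 * (T'.card : ℝ) ≤ N₁) (hBh0 : 0 ≤ Bh) (hBh : ∀ z ∈ cthickening (2 * ε₀) (tsupport φ), ‖h z‖ ≤ Bh) (hη : 0 < η) (hη1 : η ≤ 1) (hconv : ∀ s : Site 2, IsLatticeSite S s → (δ : ℂ) * triEmbed s ∈ cthickening (2 * ε₀) (tsupport φ) → ‖hh s - h ((δ : ℂ) * triEmbed s)‖ < η) (hΨ : ∀ z, ‖A * ((2 : ℂ)⁻¹ * (fderiv ℝ φ z 1 - I * fderiv ℝ φ z I)) + B * dbarAlong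 1 φ z‖ ≤ CΨ), ‖(δ : ℂ) ^ 2 * ∑ s ∈ (S.biUnion hexFaceVertices).filter (fun s => (δ : ℂ) * triEmbed s ∈ cthickening (2 * ε₀) (tsupport φ)), ∑ k : Fin 6, φ ((δ : ℂ) * hexMidpoint (edge s k)) * w k * (F (edge s k) / Fb) + (δ : ℂ) ^ 2 * ∑ s ∈ (S.biUnion hexFaceVertices).filter (fun s => (δ : ℂ) * triEmbed s ∈ cthickening (2 * ε₀) (tsupport φ)), h ((δ : ℂ) * triEmbed s) * (A * ((2 : ℂ)⁻¹ * (fderiv ℝ φ ((δ : ℂ) * triEmbed s) 1 - I * fderiv ℝ φ ((δ : ℂ) * triEmbed s) I)) + B * dbarAlong 1 φ ((δ : ℂ) * triEmbed s))‖ ≤ δ * (L * C₁ + 24 * M * (Bh + 1) * N₁) + η * CΨ * N₁ :=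
  @one_scale

end Summit.CriticalPhenomena.SAWScalingLimit.Theorems.PickHalfPlane.DevelopingMap

end
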